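import Summits.QuantumAdvantage.QuantumAdvantage.Theorems.CharDialFormJuntaD

/-! # CharDialFormJuntaE — part 5/6 (mechanical split for landing of `CharDialFormJunta`; content verbatim; scopes re-opened with their variables) -/

noncomputable section
open Finset

namespace Summit.QuantumAdvantage.AdviceFreeQNC0.WindowCounter
open Summit.QuantumAdvantage.AdviceFreeQNC0

section BlockProduct
variable (p : ℕ) [Fact p.Prime] {n : ℕ}

/-- CharDialFormJuntaE helper `linF_setBlk` (decomp-qadv land package; see the module docstring). -/
theorem linF_setBlk (a : Fin n → ZMod p) (k : ℕ) (hk : k + 3 ≤ n) (X : Fin 3 → Bool) (u : Fin n → Bool) :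
    linF p a (setBlk k X u) + blkF p a k (getBlk k hk u) = linF p a u + blkF p a k X := by
  have h := sum_setBlk_split k hk X u a
  have e : ∀ Y : Fin 3 → Bool, blkF p a k Y = ∑ j : Fin 3, if Y j = true then a ⟨k + j.val, by omega⟩ else 0 := fun Y =>
    sum_congr rfl fun j _ => by
      have : aExt p a (k + j.val) = a ⟨k + j.val, by omega⟩ := by unfold aExt; rw [dif_pos (by omega)]
      rw [this]
  unfold linF; rw [e, e]; exact h

/-! ### cuts touching a block; sign congruence -/

/-- cut `g` TOUCHES the block at `k` (a `Bool`): it reads one of its bits, or it sits inside it. -/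
def touch (J : Fin (n + 1) → Finset (Fin n)) (g : Fin (n + 1)) (k : ℕ) : Bool :=
  decide ((∃ i ∈ J g, k ≤ i.val ∧ i.val < k + 3) ∨ (g.val = k + 1 ∨ g.val = k + 2))

variable (y : Fin (n + 1) → (Fin n → Bool) → Bool) (c : ℕ) (J : Fin (n + 1) → Finset (Fin n))

/-- **sign congruence**: a cut that does not touch the block does not notice an in-class change of its content. -/
theorem fires_setBlk_congr (hJ : ∀ g u v, (∀ i ∈ J g, u i = v i) → y g u = y g v) {k : ℕ} (hk : k + 3 ≤ n)
    {g : Fin (n + 1)} (hg : ¬ (touch J g k = true)) {X X' : Fin 3 → Bool} (hXX : wt X % 3 = wt X' % 3) (z : Fin n → Bool) :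
    fires y c g (setBlk k X z) = fires y c g (setBlk k X' z) := by
  have hy : y g (setBlk k X z) = y g (setBlk k X' z) := hJ g _ _ fun i hi => by
    have hni : ¬ (k ≤ i.val ∧ i.val < k + 3) := fun h => hg (decide_eq_true (Or.inl ⟨i, hi, h⟩))
    rw [setBlk_of_not X z hni, setBlk_of_not X' z hni]
  have hw := wt_setBlk k hk X z
  have hw' := wt_setBlk k hk X' z
  have hgk : g.val ≤ k ∨ k + 3 ≤ g.val := by
    by_contra h; push Not at h; exact hg (decide_eq_true (Or.inr (by omega)))
  have hP : wtPrefix (setBlk k X z) g.val % 3 = wtPrefix (setBlk k X' z) g.val % 3 := by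
    rcases hgk with h | h
    · rw [(wtPrefix_setBlk k hk X z g.val).1 h, (wtPrefix_setBlk k hk X' z g.val).1 h]
    · have h1 := (wtPrefix_setBlk k hk X z g.val).2 h
      have h2 := (wtPrefix_setBlk k hk X' z g.val).2 h
      omega
  have hmod : (c + g.val + walkExp (setBlk k X z) g.val) % 3 = (c + g.val + walkExp (setBlk k X' z) g.val) % 3 := by
    unfold walkExp; omega
  unfold fires; rw [hy, hmod]

/-! ### the summand `Q = F · ψ` and its four-point exchange identity -/

/-- `Q(u) = (∏_g sgn fires_g u) · ψ_p(t⟨a,u⟩)`. -/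
def Qf (a : Fin n → ZMod p) (t : ZMod p) (u : Fin n → Bool) : ℂ :=
  (∏ g : Fin (n + 1), sgn (fires y c g u)) * (ZMod.stdAddChar (t * linF p a u) : ℂ)

/-- CharDialFormJuntaE helper `exists_prod_sgn_eq` (decomp-qadv land package; see the module docstring). -/
theorem exists_prod_sgn_eq {ι : Type*} (s : Finset ι) (f : ι → Bool) : ∃ b : Bool, ∏ x ∈ s, sgn (f x) = sgn b := by
  classical
  induction s using Finset.induction_on with
  | empty => exact ⟨false, by simp⟩
  | insert x s hx ih =>
    obtain ⟨b, hb⟩ := ih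
    exact ⟨xor (f x) b, by rw [prod_insert hx, hb, sgn_mul_sgn]⟩

/-- CharDialFormJuntaE helper `norm_Qf` (decomp-qadv land package; see the module docstring). -/
theorem norm_Qf (a : Fin n → ZMod p) (t : ZMod p) (u : Fin n → Bool) : ‖Qf p y c a t u‖ = 1 := by
  unfold Qf
  obtain ⟨b, hb⟩ := exists_prod_sgn_eq (univ : Finset (Fin (n + 1))) (fun g => fires y c g u)
  rw [norm_mul, hb, norm_sgn, norm_char, one_mul]

/-- CharDialFormJuntaE helper `Qf_ne_zero` (decomp-qadv land package; see the module docstring). -/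
theorem Qf_ne_zero (a : Fin n → ZMod p) (t : ZMod p) (u : Fin n → Bool) : Qf p y c a t u ≠ 0 := by
  intro h; have := norm_Qf p y c a t u; rw [h, norm_zero] at this; exact zero_ne_one this

/-- **the four-point exchange identity** for two separated blocks that no cut touches simultaneously. -/
theorem Qf_exchange (hJ : ∀ g u v, (∀ i ∈ J g, u i = v i) → y g u = y g v) (a : Fin n → ZMod p) (t : ZMod p)
    {k₀ k₁ : ℕ} (hk₀ : k₀ + 3 ≤ n) (hk₁ : k₁ + 3 ≤ n) (hsep : k₀ + 3 ≤ k₁ ∨ k₁ + 3 ≤ k₀)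
    (hni : ∀ g, touch J g k₀ = true → ¬ (touch J g k₁ = true)) {X X' Y Y' : Fin 3 → Bool}
    (hX : wt X % 3 = wt X' % 3) (hY : wt Y % 3 = wt Y' % 3) (z : Fin n → Bool) :
    Qf p y c a t (setBlk k₁ Y (setBlk k₀ X' z)) * Qf p y c a t (setBlk k₁ Y' (setBlk k₀ X z)) =
      Qf p y c a t (setBlk k₁ Y (setBlk k₀ X z)) * Qf p y c a t (setBlk k₁ Y' (setBlk k₀ X' z)) := by
  -- signs, cut by cut
  have hsg : ∀ g : Fin (n + 1),
      sgn (fires y c g (setBlk k₁ Y (setBlk k₀ X' z))) * sgn (fires y c g (setBlk k₁ Y' (setBlk k₀ X z))) =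
      sgn (fires y c g (setBlk k₁ Y (setBlk k₀ X z))) * sgn (fires y c g (setBlk k₁ Y' (setBlk k₀ X' z))) := by
    intro g
    by_cases h1 : touch J g k₁ = true
    · have h0 : ¬ (touch J g k₀ = true) := fun h => hni g h h1
      rw [setBlk_comm hsep.symm Y X', setBlk_comm hsep.symm Y' X, setBlk_comm hsep.symm Y X, setBlk_comm hsep.symm Y' X',
        fires_setBlk_congr y c J hJ hk₀ h0 hX.symm (setBlk k₁ Y z), fires_setBlk_congr y c J hJ hk₀ h0 hX (setBlk k₁ Y' z)]
    · rw [fires_setBlk_congr y c J hJ hk₁ h1 hY (setBlk k₀ X' z), fires_setBlk_congr y c J hJ hk₁ h1 hY.symm (setBlk k₀ X z),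
        mul_comm]
  have hF : (∏ g : Fin (n + 1), sgn (fires y c g (setBlk k₁ Y (setBlk k₀ X' z)))) *
      (∏ g : Fin (n + 1), sgn (fires y c g (setBlk k₁ Y' (setBlk k₀ X z)))) =
      (∏ g : Fin (n + 1), sgn (fires y c g (setBlk k₁ Y (setBlk k₀ X z)))) *
      (∏ g : Fin (n + 1), sgn (fires y c g (setBlk k₁ Y' (setBlk k₀ X' z)))) := by
    rw [← prod_mul_distrib, ← prod_mul_distrib]; exact prod_congr rfl fun g _ => hsg g
  -- forms
  have hL : linF p a (setBlk k₁ Y (setBlk k₀ X' z)) + linF p a (setBlk k₁ Y' (setBlk k₀ X z)) =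
      linF p a (setBlk k₁ Y (setBlk k₀ X z)) + linF p a (setBlk k₁ Y' (setBlk k₀ X' z)) := by
    have e1 := linF_setBlk p a k₁ hk₁ Y (setBlk k₀ X' z)
    have e2 := linF_setBlk p a k₁ hk₁ Y' (setBlk k₀ X z)
    have e3 := linF_setBlk p a k₁ hk₁ Y (setBlk k₀ X z)
    have e4 := linF_setBlk p a k₁ hk₁ Y' (setBlk k₀ X' z)
    have f1 := linF_setBlk p a k₀ hk₀ X' z
    have f2 := linF_setBlk p a k₀ hk₀ X z
    rw [getBlk_setBlk_of_sep hk₁ hsep.symm] at e1 e2 e3 e4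
    linear_combination e1 + e2 - e3 - e4
  unfold Qf
  calc _ = ((∏ g : Fin (n + 1), sgn (fires y c g (setBlk k₁ Y (setBlk k₀ X' z)))) *
        (∏ g : Fin (n + 1), sgn (fires y c g (setBlk k₁ Y' (setBlk k₀ X z))))) *
        (ZMod.stdAddChar (t * (linF p a (setBlk k₁ Y (setBlk k₀ X' z)) + linF p a (setBlk k₁ Y' (setBlk k₀ X z)))) : ℂ) := by
          rw [mul_add, AddChar.map_add_eq_mul]; ring
    _ = ((∏ g : Fin (n + 1), sgn (fires y c g (setBlk k₁ Y (setBlk k₀ X z)))) *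
        (∏ g : Fin (n + 1), sgn (fires y c g (setBlk k₁ Y' (setBlk k₀ X' z))))) *
        (ZMod.stdAddChar (t * (linF p a (setBlk k₁ Y (setBlk k₀ X z)) + linF p a (setBlk k₁ Y' (setBlk k₀ X' z)))) : ℂ) := by
          rw [hF, hL]
    _ = _ := by rw [mul_add, AddChar.map_add_eq_mul]; ring

/-- **the contracting pair of a good block**: two patterns of one weight class whose forms differ. -/
theorem norm_Qf_pair_le (a : Fin n → ZMod p) {t : ZMod p} {k : ℕ} (hk : k + 3 ≤ n) {X X' : Fin 3 → Bool}
    (hΔ : t * (blkF p a k X' - blkF p a k X) ≠ 0) (z : Fin n → Bool) :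
    ‖Qf p y c a t (setBlk k X z) + Qf p y c a t (setBlk k X' z)‖ ≤ betaF p := by
  obtain ⟨b, hb⟩ := exists_prod_sgn_eq (univ : Finset (Fin (n + 1))) (fun g => fires y c g (setBlk k X z))
  obtain ⟨b', hb'⟩ := exists_prod_sgn_eq (univ : Finset (Fin (n + 1))) (fun g => fires y c g (setBlk k X' z))
  have hlin : linF p a (setBlk k X' z) = linF p a (setBlk k X z) + (blkF p a k X' - blkF p a k X) := by
    have e1 := linF_setBlk p a k hk X z
    have e2 := linF_setBlk p a k hk X' z
    linear_combination e2 - e1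
  unfold Qf
  rw [hb, hb', hlin, mul_add t, AddChar.map_add_eq_mul]
  have := norm_pair_le (ZMod.stdAddChar (t * linF p a (setBlk k X z)) : ℂ)
    (ZMod.stdAddChar (t * (blkF p a k X' - blkF p a k X)) : ℂ) (norm_char _ _) (le_betaF p hΔ).1 (le_betaF p hΔ).2 b b'
  calc _ = ‖(ZMod.stdAddChar (t * linF p a (setBlk k X z)) : ℂ) * sgn b +
        (ZMod.stdAddChar (t * linF p a (setBlk k X z)) : ℂ) * (ZMod.stdAddChar (t * (blkF p a k X' - blkF p a k X)) : ℂ) *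
          sgn b'‖ := by ring_nf
    _ ≤ betaF p := this

end BlockProduct

section BlockProduct2

variable (p : ℕ) [Fact p.Prime] {n : ℕ}
variable (y : Fin (n + 1) → (Fin n → Bool) → Bool) (c : ℕ) (J : Fin (n + 1) → Finset (Fin n))

/-! ### 8-to-1 averaging over one block -/

/-- CharDialFormJuntaE helper `sum_setBlk` (decomp-qadv land package; see the module docstring). -/
theorem sum_setBlk (k : ℕ) (hk : k + 3 ≤ n) (R : (Fin n → Bool) → ℂ) :
    ∑ X : Fin 3 → Bool, ∑ u : Fin n → Bool, R (setBlk k X u) = 8 * ∑ u, R u := by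
  have hinv : Function.Involutive (fun q : (Fin 3 → Bool) × (Fin n → Bool) => (getBlk k hk q.2, setBlk k q.1 q.2)) := by
    rintro ⟨X, u⟩; simp only [getBlk_setBlk, setBlk_setBlk, setBlk_getBlk]
  rw [← Fintype.sum_prod_type' (f := fun X u => R (setBlk k X u))]
  calc ∑ q : (Fin 3 → Bool) × (Fin n → Bool), R (setBlk k q.1 q.2)
      = ∑ q : (Fin 3 → Bool) × (Fin n → Bool), R (hinv.toPerm _ q).2 := rfl
    _ = ∑ q : (Fin 3 → Bool) × (Fin n → Bool), R q.2 :=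
        Fintype.sum_equiv (hinv.toPerm _) _ (fun q => R q.2) (fun q => rfl)
    _ = 8 * ∑ u, R u := by
        rw [Fintype.sum_prod_type]
        simp only [sum_const, card_univ, nsmul_eq_mul]
        norm_num

/-! ### weight classes and class-restricted multi-block sums -/

/-- the weight class `cl` of 3-bit block patterns. -/
def Cl (cl : ℕ) : Finset (Fin 3 → Bool) := univ.filter fun X => wt X % 3 = cl

/-- CharDialFormJuntaE helper `mem_Cl` (decomp-qadv land package; see the module docstring). -/
theorem mem_Cl {cl : ℕ} {X : Fin 3 → Bool} : X ∈ Cl cl ↔ wt X % 3 = cl := by simp [Cl]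

/-- CharDialFormJuntaE helper `card_Cl` (decomp-qadv land package; see the module docstring). -/
theorem card_Cl : (Cl 0).card = 2 ∧ (Cl 1).card = 3 ∧ (Cl 2).card = 3 := by
  refine ⟨?_, ?_, ?_⟩ <;> decide

/-- CharDialFormJuntaE helper `sum_Cl` (decomp-qadv land package; see the module docstring). -/
theorem sum_Cl {M : Type*} [AddCommMonoid M] (f : (Fin 3 → Bool) → M) :
    ∑ c₀ : Fin 3, ∑ X ∈ Cl c₀.val, f X = ∑ X, f X := by
  unfold Cl
  rw [Fin.sum_univ_eq_sum_range (fun cl => ∑ X ∈ univ.filter (fun X : Fin 3 → Bool => wt X % 3 = cl), f X) 3]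
  exact Finset.sum_fiberwise_of_maps_to (g := fun X : Fin 3 → Bool => wt X % 3)
    (fun X _ => by simp only [mem_range]; omega) f

/-- class representative. -/
def rep (cl : ℕ) : Fin 3 → Bool := fun j => decide (j.val < cl)

/-- CharDialFormJuntaE helper `wt_rep_mod` (decomp-qadv land package; see the module docstring). -/
theorem wt_rep_mod {cl : ℕ} (hcl : cl < 3) : wt (rep cl) % 3 = cl := by
  interval_cases cl <;> decide

/-- CLASS-RESTRICTED MULTI-BLOCK SUM over the blocks `k j` with prescribed classes `cl j`. -/
def msum (Q : (Fin n → Bool) → ℂ) : (m : ℕ) → (Fin m → ℕ) → (Fin m → ℕ) → (Fin n → Bool) → ℂ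
  | 0, _, _, u => Q u
  | m + 1, k, cl, u => ∑ X ∈ Cl (cl 0), msum Q m (Fin.tail k) (Fin.tail cl) (setBlk (k 0) X u)

/-- overwrite every block by its class representative. -/
def fill : (m : ℕ) → (Fin m → ℕ) → (Fin m → ℕ) → (Fin n → Bool) → (Fin n → Bool)
  | 0, _, _, u => u
  | m + 1, k, cl, u => fill m (Fin.tail k) (Fin.tail cl) (setBlk (k 0) (rep (cl 0)) u)

/-- CharDialFormJuntaE helper `msum_zero` (decomp-qadv land package; see the module docstring). -/
theorem msum_zero (Q : (Fin n → Bool) → ℂ) (k cl : Fin 0 → ℕ) (u : Fin n → Bool) : msum Q 0 k cl u = Q u := rfl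
/-- CharDialFormJuntaE helper `msum_succ` (decomp-qadv land package; see the module docstring). -/
theorem msum_succ (Q : (Fin n → Bool) → ℂ) {m : ℕ} (k cl : Fin (m + 1) → ℕ) (u : Fin n → Bool) :
    msum Q (m + 1) k cl u = ∑ X ∈ Cl (cl 0), msum Q m (Fin.tail k) (Fin.tail cl) (setBlk (k 0) X u) := rfl
/-- CharDialFormJuntaE helper `fill_zero` (decomp-qadv land package; see the module docstring). -/
theorem fill_zero (k cl : Fin 0 → ℕ) (u : Fin n → Bool) : fill 0 k cl u = u := rfl
/-- CharDialFormJuntaE helper `fill_succ` (decomp-qadv land package; see the module docstring). -/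
theorem fill_succ {m : ℕ} (k cl : Fin (m + 1) → ℕ) (u : Fin n → Bool) :
    fill (m + 1) k cl u = fill m (Fin.tail k) (Fin.tail cl) (setBlk (k 0) (rep (cl 0)) u) := rfl

/-- CharDialFormJuntaE helper `fill_setBlk_comm` (decomp-qadv land package; see the module docstring). -/
theorem fill_setBlk_comm {k₀ : ℕ} (X : Fin 3 → Bool) : ∀ (m : ℕ) (k cl : Fin m → ℕ),
    (∀ j, k₀ + 3 ≤ k j ∨ k j + 3 ≤ k₀) → ∀ u : Fin n → Bool, fill m k cl (setBlk k₀ X u) = setBlk k₀ X (fill m k cl u) := by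
  intro m; induction m with
  | zero => intro k cl _ u; rfl
  | succ m ih =>
    intro k cl hsep u
    rw [fill_succ, fill_succ, setBlk_comm (hsep 0).symm (rep (cl 0)) X u, ih (Fin.tail k) (Fin.tail cl) (fun j => hsep j.succ)]

/-- **the ratio property**: changing the outer block's content within its class rescales the whole inner
class-restricted sum by one unit scalar (read off at the representative filling). -/
theorem msum_ratio (hJ : ∀ g u v, (∀ i ∈ J g, u i = v i) → y g u = y g v) (a : Fin n → ZMod p) (t : ZMod p)
    {k₀ : ℕ} (hk₀ : k₀ + 3 ≤ n) {X X' : Fin 3 → Bool} (hXX : wt X % 3 = wt X' % 3) :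
    ∀ (m : ℕ) (k cl : Fin m → ℕ), (∀ j, k j + 3 ≤ n) → (∀ j, k₀ + 3 ≤ k j ∨ k j + 3 ≤ k₀) →
      (∀ j j', j ≠ j' → k j + 3 ≤ k j' ∨ k j' + 3 ≤ k j) → (∀ g j, touch J g k₀ = true → ¬ (touch J g (k j) = true)) →
      (∀ j, cl j < 3) → ∀ v : Fin n → Bool,
        msum (Qf p y c a t) m k cl (setBlk k₀ X' v) * Qf p y c a t (fill m k cl (setBlk k₀ X v)) =
          msum (Qf p y c a t) m k cl (setBlk k₀ X v) * Qf p y c a t (fill m k cl (setBlk k₀ X' v)) := by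
  intro m; induction m with
  | zero => intro k cl _ _ _ _ _ v; simp only [msum_zero, fill_zero]; ring
  | succ m ih =>
    intro k cl hk hsep₀ hsep hni₀ hcl v
    have hk' : ∀ j : Fin m, Fin.tail k j + 3 ≤ n := fun j => hk j.succ
    have hsep₀' : ∀ j : Fin m, k₀ + 3 ≤ Fin.tail k j ∨ Fin.tail k j + 3 ≤ k₀ := fun j => hsep₀ j.succ
    have hsep' : ∀ j j' : Fin m, j ≠ j' → Fin.tail k j + 3 ≤ Fin.tail k j' ∨ Fin.tail k j' + 3 ≤ Fin.tail k j :=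
      fun j j' h => hsep j.succ j'.succ fun e => h (Fin.succ_inj.1 e)
    have hni₀' : ∀ g (j : Fin m), touch J g k₀ = true → ¬ (touch J g (Fin.tail k j) = true) := fun g j => hni₀ g j.succ
    have hcl' : ∀ j : Fin m, Fin.tail cl j < 3 := fun j => hcl j.succ
    have h0sep : ∀ j : Fin m, k 0 + 3 ≤ Fin.tail k j ∨ Fin.tail k j + 3 ≤ k 0 :=
      fun j => hsep 0 j.succ (Fin.succ_ne_zero j).symm
    have hfill : ∀ Z W : Fin 3 → Bool, fill m (Fin.tail k) (Fin.tail cl) (setBlk (k 0) W (setBlk k₀ Z v)) =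
        setBlk (k 0) W (setBlk k₀ Z (fill m (Fin.tail k) (Fin.tail cl) v)) := fun Z W => by
      rw [fill_setBlk_comm W m _ _ h0sep, fill_setBlk_comm Z m _ _ hsep₀']
    rw [msum_succ, msum_succ, fill_succ, fill_succ, hfill X (rep (cl 0)), hfill X' (rep (cl 0)), sum_mul, sum_mul]
    refine sum_congr rfl fun Y hY => ?_
    have hYc : wt Y % 3 = wt (rep (cl 0)) % 3 := by rw [mem_Cl.1 hY, wt_rep_mod (hcl 0)]
    have I := ih (Fin.tail k) (Fin.tail cl) hk' hsep₀' hsep' hni₀' hcl' (setBlk (k 0) Y v)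
    rw [setBlk_comm (hsep₀ 0) X' Y v, setBlk_comm (hsep₀ 0) X Y v, hfill X Y, hfill X' Y] at I
    have E := Qf_exchange p y c J hJ a t hk₀ (hk 0) (hsep₀ 0) (fun g hg => hni₀ g 0 hg) hXX hYc
      (fill m (Fin.tail k) (Fin.tail cl) v)
    have hne := Qf_ne_zero p y c a t (setBlk (k 0) Y (setBlk k₀ X (fill m (Fin.tail k) (Fin.tail cl) v)))
    have key : (msum (Qf p y c a t) m (Fin.tail k) (Fin.tail cl) (setBlk (k 0) Y (setBlk k₀ X' v)) *
        Qf p y c a t (setBlk (k 0) (rep (cl 0)) (setBlk k₀ X (fill m (Fin.tail k) (Fin.tail cl) v))) -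
        msum (Qf p y c a t) m (Fin.tail k) (Fin.tail cl) (setBlk (k 0) Y (setBlk k₀ X v)) *
        Qf p y c a t (setBlk (k 0) (rep (cl 0)) (setBlk k₀ X' (fill m (Fin.tail k) (Fin.tail cl) v)))) *
        Qf p y c a t (setBlk (k 0) Y (setBlk k₀ X (fill m (Fin.tail k) (Fin.tail cl) v))) = 0 := by
      linear_combination (Qf p y c a t (setBlk (k 0) (rep (cl 0)) (setBlk k₀ X (fill m (Fin.tail k) (Fin.tail cl) v)))) * I
        + (msum (Qf p y c a t) m (Fin.tail k) (Fin.tail cl) (setBlk (k 0) Y (setBlk k₀ X v))) * E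
    rcases mul_eq_zero.1 key with h | h
    · exact sub_eq_zero.1 h
    · exact absurd h hne

/-! ### the per-block class factors and the bound -/

/-- the forms of the contracting pair of a good block differ. -/
theorem blkF_pair (hp : 5 ≤ p) (a : Fin n → ZMod p) {t : ZMod p} (ht : t ≠ 0) {k : ℕ} (hgd : aExt p a k ≠ 0) :
    t * (blkF p a k (XF' p a k) - blkF p a k (XF p a k)) ≠ 0 := by
  refine mul_ne_zero ht ?_
  have e100 : blkF p a k P100 = aExt p a k := by simp [blkF, P100, Fin.sum_univ_three]
  have e010 : blkF p a k P010 = aExt p a (k + 1) := by simp [blkF, P010, Fin.sum_univ_three]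
  have e001 : blkF p a k P001 = aExt p a (k + 2) := by simp [blkF, P001, Fin.sum_univ_three]
  have e000 : blkF p a k P000 = 0 := by simp [blkF, P000, Fin.sum_univ_three]
  have e111 : blkF p a k P111 = aExt p a k + aExt p a (k + 1) + aExt p a (k + 2) := by
    simp [blkF, P111, Fin.sum_univ_three]
  unfold XF XF'
  split_ifs with h1 h2
  · rw [e010, e100]; exact sub_ne_zero.2 (Ne.symm h1)
  · rw [e001, e010]; exact sub_ne_zero.2 (Ne.symm h2)
  · push Not at h1 h2
    rw [e111, e000, ← h2, ← h1, sub_zero]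
    have : aExt p a k + aExt p a k + aExt p a k = ((3 : ℕ) : ZMod p) * aExt p a k := by push_cast; ring
    rw [this]; exact mul_ne_zero (three_ne_zero' p hp) hgd

/-- CharDialFormJuntaE helper `wt_XF_mod` (decomp-qadv land package; see the module docstring). -/
theorem wt_XF_mod (a : Fin n → ZMod p) (k : ℕ) : wt (XF p a k) % 3 = wt (XF' p a k) % 3 := by
  rcases wt_XF p a k with h | h
  · rw [h]
  · rw [h, Nat.add_mod_right]

/-- per-block class factor: `#Cl`, minus `2 − β` in the contracting class of the block. -/
def bcl (a : Fin n → ZMod p) (k cl : ℕ) : ℝ :=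
  ((Cl cl).card : ℝ) - if cl = wt (XF p a k) % 3 then 2 - betaF p else 0

/-- CharDialFormJuntaE helper `sum_bcl` (decomp-qadv land package; see the module docstring). -/
theorem sum_bcl (a : Fin n → ZMod p) (k : ℕ) : ∑ c₀ : Fin 3, bcl p a k c₀.val = 6 + betaF p := by
  have hlt : wt (XF p a k) % 3 < 3 := Nat.mod_lt _ (by norm_num)
  simp only [Fin.sum_univ_three, bcl, Fin.val_zero, Fin.val_one, Fin.val_two, card_Cl.1, card_Cl.2.1, card_Cl.2.2]
  generalize wt (XF p a k) % 3 = e at hlt ⊢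
  interval_cases e <;> norm_num <;> ring

/-- **THE BLOCK-PRODUCT BOUND** on class-restricted sums: `‖msum‖ ≤ ∏_j bcl_j`. -/
theorem msum_bound (hp : 5 ≤ p) (hJ : ∀ g u v, (∀ i ∈ J g, u i = v i) → y g u = y g v) (a : Fin n → ZMod p)
    {t : ZMod p} (ht : t ≠ 0) :
    ∀ (m : ℕ) (k cl : Fin m → ℕ), (∀ j, k j + 3 ≤ n) → (∀ j j', j ≠ j' → k j + 3 ≤ k j' ∨ k j' + 3 ≤ k j) →
      (∀ g j j', j ≠ j' → touch J g (k j) = true → ¬ (touch J g (k j') = true)) → (∀ j, aExt p a (k j) ≠ 0) → (∀ j, cl j < 3) →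
      ∀ u : Fin n → Bool, ‖msum (Qf p y c a t) m k cl u‖ ≤ ∏ j, bcl p a (k j) (cl j) := by
  intro m; induction m with
  | zero => intro k cl _ _ _ _ _ u; simp [msum_zero, norm_Qf]
  | succ m ih =>
    intro k cl hk hsep hni hgd hcl u
    have hk' : ∀ j : Fin m, Fin.tail k j + 3 ≤ n := fun j => hk j.succ
    have hsep' : ∀ j j' : Fin m, j ≠ j' → Fin.tail k j + 3 ≤ Fin.tail k j' ∨ Fin.tail k j' + 3 ≤ Fin.tail k j :=
      fun j j' h => hsep j.succ j'.succ fun e => h (Fin.succ_inj.1 e)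
    have hni' : ∀ g (j j' : Fin m), j ≠ j' → touch J g (Fin.tail k j) = true → ¬ (touch J g (Fin.tail k j') = true) :=
      fun g j j' h => hni g j.succ j'.succ fun e => h (Fin.succ_inj.1 e)
    have hgd' : ∀ j : Fin m, aExt p a (Fin.tail k j) ≠ 0 := fun j => hgd j.succ
    have hcl' : ∀ j : Fin m, Fin.tail cl j < 3 := fun j => hcl j.succ
    have h0sep : ∀ j : Fin m, k 0 + 3 ≤ Fin.tail k j ∨ Fin.tail k j + 3 ≤ k 0 :=
      fun j => hsep 0 j.succ (Fin.succ_ne_zero j).symm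
    have hni0 : ∀ g (j : Fin m), touch J g (k 0) = true → ¬ (touch J g (Fin.tail k j) = true) :=
      fun g j => hni g 0 j.succ (Fin.succ_ne_zero j).symm
    have hT : ∀ X, ‖msum (Qf p y c a t) m (Fin.tail k) (Fin.tail cl) (setBlk (k 0) X u)‖ ≤
        ∏ j : Fin m, bcl p a (Fin.tail k j) (Fin.tail cl j) := fun X => ih _ _ hk' hsep' hni' hgd' hcl' _
    have hB0 : 0 ≤ ∏ j : Fin m, bcl p a (Fin.tail k j) (Fin.tail cl j) := le_trans (norm_nonneg _) (hT fun _ => false)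
    rw [msum_succ, Fin.prod_univ_succ]
    show _ ≤ bcl p a (k 0) (cl 0) * ∏ j : Fin m, bcl p a (Fin.tail k j) (Fin.tail cl j)
    by_cases hc0 : cl 0 = wt (XF p a (k 0)) % 3
    · -- the contracting class: peel the pair `XF, XF'`
      have hX₀ : XF p a (k 0) ∈ Cl (cl 0) := mem_Cl.2 hc0.symm
      have hwt : wt (XF p a (k 0)) % 3 = wt (XF' p a (k 0)) % 3 := wt_XF_mod p a (k 0)
      have hX₀' : XF' p a (k 0) ∈ (Cl (cl 0)).erase (XF p a (k 0)) :=
        mem_erase.2 ⟨XF'_ne p a (k 0), mem_Cl.2 (by rw [← hwt]; exact hc0.symm)⟩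
      have I := msum_ratio p y c J hJ a t (hk 0) hwt m (Fin.tail k) (Fin.tail cl) hk' h0sep hsep' hni0 hcl' u
      rw [fill_setBlk_comm (XF p a (k 0)) m _ _ h0sep, fill_setBlk_comm (XF' p a (k 0)) m _ _ h0sep] at I
      have hq := norm_Qf p y c a t (setBlk (k 0) (XF p a (k 0)) (fill m (Fin.tail k) (Fin.tail cl) u))
      have hqq := norm_Qf_pair_le p y c a (hk 0) (blkF_pair p hp a ht (hgd 0)) (fill m (Fin.tail k) (Fin.tail cl) u)
      have hpair : ‖msum (Qf p y c a t) m (Fin.tail k) (Fin.tail cl) (setBlk (k 0) (XF p a (k 0)) u) +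
          msum (Qf p y c a t) m (Fin.tail k) (Fin.tail cl) (setBlk (k 0) (XF' p a (k 0)) u)‖ ≤
          betaF p * ∏ j : Fin m, bcl p a (Fin.tail k j) (Fin.tail cl j) := by
        have e : (msum (Qf p y c a t) m (Fin.tail k) (Fin.tail cl) (setBlk (k 0) (XF p a (k 0)) u) +
            msum (Qf p y c a t) m (Fin.tail k) (Fin.tail cl) (setBlk (k 0) (XF' p a (k 0)) u)) *
            Qf p y c a t (setBlk (k 0) (XF p a (k 0)) (fill m (Fin.tail k) (Fin.tail cl) u)) =
            msum (Qf p y c a t) m (Fin.tail k) (Fin.tail cl) (setBlk (k 0) (XF p a (k 0)) u) *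
            (Qf p y c a t (setBlk (k 0) (XF p a (k 0)) (fill m (Fin.tail k) (Fin.tail cl) u)) +
              Qf p y c a t (setBlk (k 0) (XF' p a (k 0)) (fill m (Fin.tail k) (Fin.tail cl) u))) := by
          linear_combination I
        have he := congrArg (fun z : ℂ => ‖z‖) e
        simp only [norm_mul, hq, mul_one] at he
        rw [he]
        calc _ ≤ (∏ j : Fin m, bcl p a (Fin.tail k j) (Fin.tail cl j)) * betaF p :=
              mul_le_mul (hT _) hqq (norm_nonneg _) hB0
          _ = _ := mul_comm _ _
      rw [← add_sum_erase _ _ hX₀, ← add_sum_erase _ _ hX₀', ← add_assoc]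
      have h2 : 2 ≤ (Cl (cl 0)).card := by
        have h1 : 1 ≤ ((Cl (cl 0)).erase (XF p a (k 0))).card := card_pos.2 ⟨_, hX₀'⟩
        rw [card_erase_of_mem hX₀] at h1
        omega
      have hcard : (((Cl (cl 0)).erase (XF p a (k 0))).erase (XF' p a (k 0))).card = (Cl (cl 0)).card - 2 := by
        rw [card_erase_of_mem hX₀', card_erase_of_mem hX₀]; omega
      calc _ ≤ ‖msum (Qf p y c a t) m (Fin.tail k) (Fin.tail cl) (setBlk (k 0) (XF p a (k 0)) u) +
            msum (Qf p y c a t) m (Fin.tail k) (Fin.tail cl) (setBlk (k 0) (XF' p a (k 0)) u)‖ +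
            ∑ X ∈ ((Cl (cl 0)).erase (XF p a (k 0))).erase (XF' p a (k 0)),
              ‖msum (Qf p y c a t) m (Fin.tail k) (Fin.tail cl) (setBlk (k 0) X u)‖ :=
            (norm_add_le _ _).trans (by gcongr; exact norm_sum_le _ _)
        _ ≤ betaF p * (∏ j : Fin m, bcl p a (Fin.tail k j) (Fin.tail cl j)) +
            ∑ X ∈ ((Cl (cl 0)).erase (XF p a (k 0))).erase (XF' p a (k 0)),
              ∏ j : Fin m, bcl p a (Fin.tail k j) (Fin.tail cl j) := add_le_add hpair (sum_le_sum fun X _ => hT X)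
        _ = (((Cl (cl 0)).card : ℝ) - 2 + betaF p) * ∏ j : Fin m, bcl p a (Fin.tail k j) (Fin.tail cl j) := by
            rw [sum_const, hcard, nsmul_eq_mul, Nat.cast_sub h2]; push_cast; ring
        _ = bcl p a (k 0) (cl 0) * ∏ j : Fin m, bcl p a (Fin.tail k j) (Fin.tail cl j) := by
            rw [bcl, if_pos hc0]; ring
    · calc _ ≤ ∑ X ∈ Cl (cl 0), ‖msum (Qf p y c a t) m (Fin.tail k) (Fin.tail cl) (setBlk (k 0) X u)‖ := norm_sum_le _ _
        _ ≤ ∑ X ∈ Cl (cl 0), ∏ j : Fin m, bcl p a (Fin.tail k j) (Fin.tail cl j) := sum_le_sum fun X _ => hT X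
        _ = bcl p a (k 0) (cl 0) * ∏ j : Fin m, bcl p a (Fin.tail k j) (Fin.tail cl j) := by
            rw [sum_const, nsmul_eq_mul, bcl, if_neg hc0, sub_zero]


end BlockProduct2
end Summit.QuantumAdvantage.AdviceFreeQNC0.WindowCounter
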